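import Summits.QuantumFields.YangMills.Theorems.BalabanUVNodesN08Thm2AtRecordWindowExact

/-!
# BalabanUVNodes ∕ N08 — [Balaban1985UV3] Thm 2 at the runs of record: THE RECORD'S PER-RUN DATUM AT THE DEPTH-0 MEMBERS OF THE FAMILY
# (`K = 0`, `ε = ε₀`: no renormalisation step) EXISTS over the binders themselves — EXACTLY when `E(S) = 0` and the level-0 window condition
# holds; so the ∃-representation reading `Repr41_47G` is INHABITED at the slot of record (every version of (2), no seam, no `εbg > 2`)

Track A, DAG node N08 = T. Bałaban, CMP **102** (1985) 255–275 [Balaban1985UV3]: Thm 2 p. 272, (41)–(43) p. 266, (47) p. 267, (1) p. 256 «ρ₀(U) = exp[−(1/g₀²)A(U) − E]»,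
(62) p. 271 ∕ (64) p. 273 «E_k = Σ_{j=k}^{K−1} E^{(j)}», p. 256 L15–18 «L^Kε = ε₀»; [7] = [Balaban1985Variational] (2) p. 278.  Cell `pub-ymgap`, width seat
`pub-ymgap-dag-n08-w1` (g2), W-SEAT-START-LIST §n08 item 1 successor piece (o3) = file 10; `--supports` K1⁷ `StabilityBAtRecordR13SepCoPH` (helper).
Companion of `…N08Thm2AtRecordWindowExact` (file 8: (47)₀ at the record's binders ⟺ `ε₁(0) ≤ εbg ∨ 2 < εbg`), `…LevelZero` §4 (the per-run datum gives (5)-compact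
run by run) and `…SeamK0` ∕ `…BridgeInhabited` (the d = 3 lane's towers re-base to the record's binders only for `εbg > 2` — a seam of the lane's `U₀ := id`).

WHAT THIS FILE PROVES (kernel; theorems only, 0 def; nothing of the paper asserted).
* §1 ★ TOWER OBJECTS OVER THE RECORD'S BINDERS THEMSELVES (`exists_towerObjects_over_binders`): for ANY averaging family `𝔞`, ANY version `𝔗` of (2), ANY
  background assignment `𝔅`, constants `c`, lattice approximation `S` and vacuum-energy profile `E^{(j)}` with `c.E S = Σ_{j<K} E^{(j)}` ((64)), there are Sect.-B
  tower objects `W` with `W.toRunObjects = runObjects₀A N 𝔞 𝔗 𝔅 c S` ON THE NOSE — composite minimisers `U_k(V, h) := U_k(V)` of the record (so (42) at the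
  trivial history is `rfl` WHATEVER `U₀` is: NO level-0 seam, contrast `SeamK0` §2), print's k = 0 interaction data `Pint ≡ 0` ((43)), unit history masses
  (`LF 0 V F = exp (F ∅)`, (41)₀ = (1)), zero `Z`-profile, `Λ_k := T₁^{(k)}`, and the lane's `UsesConsts C` for the matching leaf constants `C`.
* §2 ★★★ `repr41_47G_zero_iff_of_depthZero` — **AT A DEPTH-0 MEMBER (`S.K = 0`) THE RECORD'S PER-RUN DATUM IS EXACTLY A CONDITION ON THE ∃-CONSTANTS**:
  `Repr41_47G N (runObjects₀A N 𝔞 𝔗 (Backgrounds.ofAvg N L 𝔞)) c S 0 ⟺ (c.E S = 0 ∧ (eps1OfPrint c S 0 ≤ c.εbg ∨ 2 < c.εbg))` (`SU(N)`, `N ≥ 2`, `c` admissible).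
  ⟹: `E = Σ_{j<0} E^{(j)} = 0` (`E_eq_zero_of_repr41_47G`, any `N`) and file 8; ⟸: §1's objects carry a full `B10Assembly.LeafSystem` at depth 0 (the fourteen step
  leaves, (46), (65)'s inputs are VACUOUS for `K = 0`; `step0` by `LevelZero`, `noInt0` by `rfl`, the large-field control at `k = 0` is `exp(−g₀⁻²A(U₀V)) ≤ 1`) through
  the lane's `leafSystem_of_concrete ∘ carrierEqs_pin` (`repr41_47G_of_depthZero`, every `N ≥ 1`, every `k ≤ K`).
* §3 CONSEQUENCES: a second NECESSARY CONDITION on the ∃-constants of the slot of record — **`c.E S = 0` at every depth-0 member** (`E_eq_zero_of_thm2Printed_runsAtG`,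
  `…_of_printedUV3V`; depth-0 members exist in every family, `exists_depthZero_member`); and NON-VACUITY (A6) of the Sect.-D-strength reading at the slot of record:
  the record's Thm-2 conjunct HOLDS ON THE DEPTH-0 SUB-FAMILY (`thm2_on_depthZero_members`) and (5)-compact holds there run by run (`thm1Compact_single_of_depthZero`),
  for EVERY version `𝔗 : TFamily₃ N L`, with no condition `εbg > 2`; all hypotheses inhabited at once by `exists_consts_repr41_47G_depthZero` (`E ≡ 0`, `εbg = 3`).

HONEST FRAMING: count-neutral helper; N08 NOT discharged; depth-0 members are the trivial end of the family (one lattice `T_{ε₀}`, no renormalisation transformation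
applied) — [Balaban1985UV3]'s content is `K ≥ 1`, where the step leaves of Sects. A∕C∕D at the record's binders remain the object gap; `PrintedUV3V` NOT proved; one
finite 𝕋⁴ programme at fixed ε, Bałaban AS PRINTED — R4 closes the conditional finite-𝕋⁴ rung `BalabanLadder.UV` only; the Yang–Mills mass gap (Clay) is NOT proved
by any of this; nothing continuum ∕ ℝ⁴ ∕ OS.  No `sorry`, standard axioms.
-/

noncomputable section

namespace Summit.QuantumFields.YangMills.BalabanUVNodes.N08Thm2AtRecordDepthZero

open Literature.MathematicalPhysics.QuantumFieldTheory.Balaban1983to89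
open Literature.MathematicalPhysics.QuantumFieldTheory.Balaban1983to89.Node00 (SU TFamily₃)
open Literature.MathematicalPhysics.QuantumFieldTheory.Balaban1983to89.B10RunsOfRecord
open Literature.MathematicalPhysics.QuantumFieldTheory.Balaban1985CMP102
open Literature.MathematicalPhysics.QuantumFieldTheory.Balaban1985CMP102.Setting
open Literature.MathematicalPhysics.QuantumFieldTheory.Balaban1985CMP102.Theorems (Family)
open Summit.QuantumFields.Balaban3D
open Summit.QuantumFields.Balaban3D.Proofs
open Summit.QuantumFields.YangMills.BalabanUVNodes.N08Thm2AtRecordLevelZero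
open Summit.QuantumFields.YangMills.BalabanUVNodes.N08Thm2AtRecordSeamK0
open Summit.QuantumFields.YangMills.BalabanUVNodes.N08Thm2AtRecordWindowExact

variable {N : ℕ} [NeZero N] {L : ℕ}

/-! ## §1 Sect.-B tower objects over the record's binders themselves (print's trivial-history data; no lane tower, no seam) -/
section Objects

variable (𝔞 : ∀ S : Scales L, ∀ j, Averaging S.P j (SU N)) (𝔗 : ∀ S : Scales L, ∀ j, RTOpI S.P j (SU N) (𝔞 S j))
  (𝔅 : Consts L → Backgrounds N L) (c : Consts L) (S : Scales L)

/-- ★ **TOWER OBJECTS EXTENDING THE RECORD'S BINDERS ON THE NOSE, for ANY averaging, version of (2) and background assignment**: composite minimisers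
`U_k(V, h) := U_k(V)` of the binders (so `UkH_triv` is `rfl` whatever `U₀` is), `Pint ≡ 0` ((43) at every level — print's k = 0 datum; trivial expansion data
above), unit history masses (`LF k V F = Σ_h exp (F h)`; at `k = 0`: `exp (F ∅)`), `Λ_k := T₁^{(k)}`, `Z ≡ 0`, `zcoef ≡ 0`, `rcoef := rstar·(g²)^{3+κ₀}`, tower
parameters `M₁, b₀, p₀, κ₀` := the leaf constants', vacuum energies `E^{(j)} := Estep j` with `c.E S = Σ_{j<K} E^{(j)}` ((64)). [cite: Balaban1985UV3, (38)–(43) p.266 + (64) p.273 (the binders; bookkeeping)] -/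
theorem exists_towerObjects_over_binders (C : B10Assembly.Consts) (Estep : ℕ → ℝ) (hE : c.E S = B10.Ek Estep S.K 0) :
    ∃ W : SectB.TowerObjects S (SU N), W.toRunObjects = runObjects₀A N 𝔞 𝔗 𝔅 c S ∧ EndTheorem.UsesConsts C W ∧
      (∀ (h : W.Hist 0) (V : GaugeField S.P 0 (SU N)), W.Pint 0 h V = 0) ∧
      (∀ (V : GaugeField S.P 0 (SU N)) (F : W.Hist 0 → ℝ), W.LF 0 V F = Real.exp (F (W.triv 0))) ∧
      (∀ (k : ℕ) (h : W.Hist k) (V : GaugeField S.P k (SU N)), W.Pint k h V = 0) ∧ W.Estep = Estep := by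
  let Wt : Carriers.HistWeights S.P (SU N) := ⟨fun _ _ _ => 1, fun _ _ _ => zero_le_one, fun _ _ _ => le_rfl, fun _ _ => rfl⟩
  refine ⟨{ toRunObjects := runObjects₀A N 𝔞 𝔗 𝔅 c S
            M₁ := C.M₁
            b₀ := C.b₀
            p₀ := C.p₀
            κ₀ := C.κ₀
            Hist := Carriers.Hist S.P
            triv := Carriers.Hist.triv S.P
            LF := fun k V F => Carriers.LF Wt k V F
            lf_mono := fun k V F F' h => Carriers.lf_mono Wt k V F F' h
            lf_shift := fun k V F t => Carriers.lf_shift Wt k V F t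
            UkH := fun k _ V => (𝔅 c).Uk S k V
            UkH_triv := fun _ _ => rfl
            Pint := fun _ _ _ => 0
            Λvol := fun k _ => S.sites k
            Λvol_le := fun _ _ => le_rfl
            plaqsIn := fun _ _ => Set.univ
            plaqsIn_triv := fun _ => rfl
            Zvol := fun _ _ _ => 0
            Zvol_triv := fun _ _ => rfl
            zcoef := fun _ => 0
            rcoef := fun _ => C.rstar * (S.g ^ 2) ^ (3 + C.κ₀)
            Estep := Estep
            E_eq := hE }, rfl, ?_, fun _ _ => rfl, fun V F => Carriers.lf_zero Wt V F, fun _ _ _ => rfl, rfl⟩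
  exact { M₁_eq := rfl, b₀_eq := rfl, p₀_eq := rfl, κ₀_eq := rfl, rcoef_eq := fun _ => rfl,
          Λvol_nonneg := fun k _ => ScalesArithmetic.sites_nonneg S k }

end Objects

/-! ## §2 Depth-0 members: the per-run datum ⟺ `E(S) = 0` ∧ the level-0 window condition -/
section DepthZero

variable {𝔞 : ∀ S : Scales L, ∀ j, Averaging S.P j (SU N)} {𝔗 : ∀ S : Scales L, ∀ j, RTOpI S.P j (SU N) (𝔞 S j)}
  {𝔅 : Consts L → Backgrounds N L} {c : Consts L} {S : Scales L}

/-- **NECESSARY: `E(S) = Σ_{j<K} E^{(j)}`** — tower objects extending the record's binders identify the Introduction's `E` with the sum (64) of their vacuum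
energies. [cite: Balaban1985UV3, (64) p.273 + (1) p.256] -/
theorem E_eq_sum_of_repr41_47G {k : ℕ} (h : Repr41_47G N (runObjects₀A N 𝔞 𝔗 𝔅) c S k) :
    ∃ Estep : ℕ → ℝ, c.E S = ∑ j ∈ Finset.range S.K, Estep j := by
  obtain ⟨-, W, hW, -, -, -⟩ := h
  refine ⟨W.Estep, ?_⟩
  have h1 : W.toRunObjects.E = c.E S := congrArg RunObjects.E hW
  rw [← h1, W.E_eq, B10.Ek_zero]

/-- ★ **NECESSARY AT DEPTH 0: `E(S) = 0`** — at a member with `K = 0` the sum (64) is empty. [cite: Balaban1985UV3, (64) p.273 + p.256 L15–18 (K = 0)] -/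
theorem E_eq_zero_of_repr41_47G (hK : S.K = 0) {k : ℕ} (h : Repr41_47G N (runObjects₀A N 𝔞 𝔗 𝔅) c S k) : c.E S = 0 := by
  obtain ⟨Estep, hE⟩ := E_eq_sum_of_repr41_47G h
  rw [hE, hK, Finset.range_zero, Finset.sum_empty]

/-- The leaf constants used at depth 0: `g := 1`, `L := L` (the lane's normalisation), `b₀, p₀ :=` the record's, the rest `0` or `1` (every O(1) of the step leaves
is irrelevant at `K = 0`). [cite: Balaban1985UV3, p.256 + (7) p.257 (bookkeeping)] -/
private theorem exists_consts (c : Consts L) (hp : 0 < c.p₀) (S : Scales L) :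
    ∃ C : B10Assembly.Consts, Constants.NormalisedConsts L C ∧ C.b₀ = c.b₀ ∧ C.p₀ = c.p₀ ∧ C.d = 0 :=
  ⟨{ g := 1, L := L, κ₀ := 1, M₁ := 0, b₀ := c.b₀, p₀ := c.p₀, C46 := 0, σmax := 0, dg := 0, z := 0, aP := 0, rstar := 0, d := 0,
     g_pos := one_pos, one_lt_L := by exact_mod_cast S.hL.2, κ₀_pos := one_pos, M₁_nonneg := le_rfl, p₀_pos := hp, C46_nonneg := le_rfl,
     σmax_nonneg := le_rfl, dg_nonneg := le_rfl, z_nonneg := le_rfl, aP_nonneg := le_rfl, rstar_nonneg := le_rfl, d_nonneg := le_rfl },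
    ⟨rfl, rfl⟩, rfl, rfl, rfl⟩

/-- ★★ **SUFFICIENT AT DEPTH 0 (every `N ≥ 1`, every averaging, every version of (2))**: at a member with `K = 0`, `E(S) = 0`, `p₀ > 0` and the level-0 window inclusion
`ε₁(0) ≤ εbg ∨ 2 < εbg`, the record's per-run datum `Repr41_47G N (runObjects₀A N 𝔞 𝔗 (Backgrounds.ofAvg N L 𝔞)) c S k` HOLDS for every `k ≤ K`: §1's objects carry a
FULL `B10Assembly.LeafSystem` — `step0` ((41)₀ every V, (47)₀ from the window; `LevelZero` §2), `noInt0` (`rfl`), the large-field control at `k = 0`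
(`exp(−g₀⁻²A(U₀V)) ≤ 1 = exp(0·|T₁|)`), the fourteen step leaves ∕ (46) ∕ (65)'s inputs VACUOUS — through the lane's `leafSystem_of_concrete ∘ carrierEqs_pin`.
[cite: Balaban1985UV3, Thm 2 p.272 + (1) p.256 + (41) p.266 + (47) p.267 + pp.272–274 (Sect. D at K = 0)] -/
theorem repr41_47G_of_depthZero (hK : S.K = 0) (hE : c.E S = 0) (hp : 0 < c.p₀) (hwin : eps1OfPrint c S 0 ≤ c.εbg ∨ 2 < c.εbg)
    (k : ℕ) (hk : k ≤ S.K) : Repr41_47G N (runObjects₀A N 𝔞 𝔗 (Backgrounds.ofAvg N L 𝔞)) c S k := by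
  obtain rfl : k = 0 := by omega
  obtain ⟨C, hC, hb, hpC, hd⟩ := exists_consts c hp S
  obtain ⟨W, hW, hUC, hP0, hLF, hPint, -⟩ := exists_towerObjects_over_binders 𝔞 𝔗 (Backgrounds.ofAvg N L 𝔞) c S C (fun _ => 0)
    (by rw [hE, B10.Ek_zero, Finset.sum_const_zero])
  -- the two inequalities at level 0
  have h41 : B10.Ineq41 W.pin.toTowerRun 0 := ineq41_zero hW hP0 fun V F => (hLF V F).symm.le
  have h47 : B10.Ineq47 W.pin.toTowerRun 0 :=
    (ineq47_zero_iff_window hW hP0).2 fun V hV _ => hwin.elim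
      (fun h => (plaqSmall_eta_zero_iff N S c.εbg V).2 (plaqSmall_mono h hV)) (fun h => plaqSmall_level_zero_of_two_lt N S h V)
  -- `K = 0` for the pinned tower run
  have hK' : W.pin.toTowerRun.K = 0 := hK
  -- the analytic leaves at depth 0
  have A : UVStability3D.AnalyticLeaves C S W.pin.toTowerRun :=
    { step0 := ⟨h41, h47⟩
      noInt0 := fun h V => hP0 h V
      steps := fun k hk => absurd hk (by rw [hK']; omega)
      bound46 := fun k h1 hk => absurd hk (by rw [hK']; omega)
      logZT_le := fun k hk => absurd hk (by rw [hK']; omega)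
      PprT_le := fun k hk => absurd hk (by rw [hK']; omega)
      lf := by
        intro k hk U
        obtain rfl : k = 0 := by rw [hK'] at hk; omega
        have h0 : W.pin.toTowerRun.LF 0 U (fun h => -(W.pin.toTowerRun.mainT 0 h U) + W.pin.toTowerRun.Zterm 0 h) =
            Real.exp (-(W.pin.toTowerRun.mainT 0 (W.pin.toTowerRun.triv 0) U) + W.pin.toTowerRun.Zterm 0 (W.pin.toTowerRun.triv 0)) :=
          hLF U _
        rw [h0, W.pin.toTowerRun.Zterm_triv 0, mainT_pin_zero_triv hW, hd, zero_mul, add_zero]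
        apply Real.exp_le_exp.mpr
        have := mul_nonneg (sq_nonneg ((S.gk 0)⁻¹)) (wilsonAction4_nonneg (UkA N 𝔞 S 0 c.εbg U))
        linarith
      starT_eq := fun k hk => absurd hk (by rw [hK']; omega)
      logσ₀_le := fun k hk => absurd hk (by rw [hK']; omega)
      dg_le := fun k hk => absurd hk (by rw [hK']; omega)
      rem_eq := fun k hk => absurd hk (by rw [hK']; omega) }
  exact ⟨C, W, hW, ⟨UVStability3D.leafSystem_of_concrete hC ⟨EndTheorem.carrierEqs_pin W hUC, A⟩⟩, h41, h47⟩

/-- ★★★ **AT A DEPTH-0 MEMBER THE RECORD'S PER-RUN DATUM IS EXACTLY A CONDITION ON THE ∃-CONSTANTS** (`SU(N)`, `N ≥ 2`, `c` admissible, `S.K = 0`; every averaging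
`𝔞`, every version `𝔗`): `Repr41_47G … c S 0 ⟺ (E(S) = 0 ∧ (ε₁(0)(S) ≤ εbg ∨ 2 < εbg))`. [cite: Balaban1985UV3, Thm 2 p.272 + (64) p.273 + (47) p.267 + (7) p.257] -/
theorem repr41_47G_zero_iff_of_depthZero (hN : 2 ≤ N) (hc : c.Adm) (hK : S.K = 0) :
    Repr41_47G N (runObjects₀A N 𝔞 𝔗 (Backgrounds.ofAvg N L 𝔞)) c S 0 ↔ (c.E S = 0 ∧ (eps1OfPrint c S 0 ≤ c.εbg ∨ 2 < c.εbg)) :=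
  ⟨fun h => ⟨E_eq_zero_of_repr41_47G hK h, consts_of_repr41_47G_zero hN hc.2.2.2 h⟩,
    fun h => repr41_47G_of_depthZero hK h.1 (by linarith [hc.2.2.1]) h.2 0 (Nat.zero_le _)⟩

/-- **At the slot of record** (`𝔞 := avOfPrint N`, `Backgrounds.ofPrint`, ANY version `𝔗 : TFamily₃ N L`): the same `iff`. [cite: Balaban1985UV3, Thm 2 p.272 + (64) p.273 + (47) p.267] -/
theorem repr41_47G_zero_iff_of_depthZero_ofPrint (hN : 2 ≤ N) {𝔗 : TFamily₃ N L} (hc : c.Adm) (hK : S.K = 0) :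
    Repr41_47G N (runObjects₀T N 𝔗 (Backgrounds.ofPrint N L)) c S 0 ↔ (c.E S = 0 ∧ (eps1OfPrint c S 0 ≤ c.εbg ∨ 2 < c.εbg)) :=
  repr41_47G_zero_iff_of_depthZero (𝔞 := avOfPrint N) hN hc hK

end DepthZero

/-! ## §3 Consequences: `E(S) = 0` at depth-0 members is NECESSARY for the slot of record; the conjunct HOLDS on the depth-0 sub-family (A6) -/
section Consequences

variable {𝔞 : ∀ S : Scales L, ∀ j, Averaging S.P j (SU N)} {𝔗 : ∀ S : Scales L, ∀ j, RTOpI S.P j (SU N) (𝔞 S j)}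
  {𝔅 : Consts L → Backgrounds N L} {c : Consts L}

/-- ★ **The record's Thm-2 conjunct FORCES `E(S) = 0` at every depth-0 member of the family** (any `N`, any background assignment). [cite: Balaban1985UV3, Thm 2 p.272 + (64) p.273] -/
theorem E_eq_zero_of_thm2Printed_runsAtG (h : B10.Thm2Printed (runsAtG N (runObjects₀A N 𝔞 𝔗 𝔅) c)) (S : Family L c.eps0) (hK : S.1.K = 0) :
    c.E S.1 = 0 :=
  E_eq_zero_of_repr41_47G hK (h S 0 (Nat.zero_le _))

/-- **… hence every witness `c` of `PrintedUV3G` at such binders has `E ≡ 0` on the depth-0 members of its family** — a second necessary condition on the ∃-constants,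
beside file 8's window condition. [cite: Balaban1985UV3, Thm 1 p.257 + Thm 2 p.272 + (64) p.273] -/
theorem E_eq_zero_of_printedUV3G (h : PrintedUV3G N L (runObjects₀A N 𝔞 𝔗 𝔅)) :
    ∃ c : Consts L, c.Adm ∧ b10AtG N (runObjects₀A N 𝔞 𝔗 𝔅) c ∧ ∀ S : Family L c.eps0, S.1.K = 0 → c.E S.1 = 0 := by
  obtain ⟨c, hc, h12⟩ := h
  exact ⟨c, hc, h12, fun S hK => E_eq_zero_of_thm2Printed_runsAtG h12.2 S hK⟩

/-- **… and for the slot of record `Node00.PrintedUV3V N L` itself.** [cite: Balaban1985UV3, Thm 1 p.257 + Thm 2 p.272 + (64) p.273] -/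
theorem E_eq_zero_of_printedUV3V (h : Node00.PrintedUV3V N L) :
    ∃ (𝔗 : TFamily₃ N L) (c : Consts L), c.Adm ∧ b10AtG N (runObjects₀T N 𝔗 (Backgrounds.ofPrint N L)) c ∧
      ∀ S : Family L c.eps0, S.1.K = 0 → c.E S.1 = 0 := by
  obtain ⟨𝔗, h𝔗⟩ := h
  exact ⟨𝔗, E_eq_zero_of_printedUV3G (𝔞 := avOfPrint N) h𝔗⟩

/-- **Depth-0 members EXIST in every family** (`Family L c.eps0`, admissible `c`): every coupling `g > 0` and volume exponent `m`, with `K = 0` (n08-a's `exists_family_member`).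
[cite: Balaban1985UV3, p.256 L15–18 (bookkeeping)] -/
theorem exists_depthZero_member (hL : Odd L ∧ 1 < L) (c : Consts L) (hc : c.Adm) (g : ℝ) (hg : 0 < g) (m : ℕ) :
    ∃ S : Family L c.eps0, S.1.g = g ∧ S.1.m = m ∧ S.1.K = 0 :=
  exists_family_member hL c hc g hg m 0

/-- ★★ **NON-VACUITY (A6) OF THE Sect.-D-STRENGTH READING: THE RECORD'S Thm-2 CONJUNCT HOLDS ON THE DEPTH-0 SUB-FAMILY** — for admissible `c` with `E(S) = 0` and the
level-0 window at the depth-0 members, `Repr41_47G … c S k` for every such member and every `k ≤ K` (every `N ≥ 1`, every averaging, every version of (2); no `εbg > 2`).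
[cite: Balaban1985UV3, Thm 2 p.272 + (1) p.256 + (47) p.267] -/
theorem thm2_on_depthZero_members (hp : 0 < c.p₀) (hE : ∀ S : Family L c.eps0, S.1.K = 0 → c.E S.1 = 0)
    (hwin : ∀ S : Family L c.eps0, S.1.K = 0 → (eps1OfPrint c S.1 0 ≤ c.εbg ∨ 2 < c.εbg))
    (S : Family L c.eps0) (hK : S.1.K = 0) (k : ℕ) (hk : k ≤ S.1.K) :
    Repr41_47G N (runObjects₀A N 𝔞 𝔗 (Backgrounds.ofAvg N L 𝔞)) c S.1 k :=
  repr41_47G_of_depthZero hK (hE S hK) hp (hwin S hK) k hk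

/-- **(5) in the compact reading HOLDS, run by run, at every depth-0 member** (through `LevelZero` §4 `thm1Compact_single_of_repr41_47G`). [cite: Balaban1985UV3, Thm 1 p.257 + Sect. D pp.272–275 (at K = 0)] -/
theorem thm1Compact_single_of_depthZero {S : Scales L} (hK : S.K = 0) (hE : c.E S = 0) (hp : 0 < c.p₀)
    (hwin : eps1OfPrint c S 0 ≤ c.εbg ∨ 2 < c.εbg) :
    B10.Thm1PrintedCompact (fun _ : Unit => (withReprSlot N (runObjects₀A N 𝔞 𝔗 (Backgrounds.ofAvg N L 𝔞)) c S).toRunData) :=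
  thm1Compact_single_of_repr41_47G N _ c (repr41_47G_of_depthZero hK hE hp hwin 0 (Nat.zero_le _))

/-- ★ **AT THE SLOT OF RECORD, ANY VERSION `𝔗 : TFamily₃ N L`**: with `E(S) = 0` and the window at a depth-0 member, the ∃-representation reading of «ρ_k satisfies
(41), (47)» HOLDS there — the first INHABITED instance of the record's per-run datum at `runObjects₀T N 𝔗 (Backgrounds.ofPrint N L)` (no seam: `U₀` of record is read
through `U_k(V, ∅) := U_k(V)`). [cite: Balaban1985UV3, Thm 2 p.272 + (5) p.256 L35–36] -/
theorem repr41_47G_ofPrint_of_depthZero {𝔗 : TFamily₃ N L} {S : Scales L} (hK : S.K = 0) (hE : c.E S = 0) (hp : 0 < c.p₀)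
    (hwin : eps1OfPrint c S 0 ≤ c.εbg ∨ 2 < c.εbg) (k : ℕ) (hk : k ≤ S.K) :
    Repr41_47G N (runObjects₀T N 𝔗 (Backgrounds.ofPrint N L)) c S k :=
  repr41_47G_of_depthZero (𝔞 := avOfPrint N) hK hE hp hwin k hk

/-- **NON-VACUITY (A6) OF §3's HYPOTHESES, ALL AT ONCE**: admissible constants with `E ≡ 0` and `εbg = 3 > 2` (`ε₀`, `b₀`, `p₀` the documented junk of
`Consts.junk`) carry the record's per-run datum at EVERY depth-0 lattice approximation, for every averaging `𝔞` and every version `𝔗` of (2).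
[cite: Balaban1985UV3, Thm 2 p.272 + p.256 L15–18 (bookkeeping)] -/
theorem exists_consts_repr41_47G_depthZero (N : ℕ) [NeZero N] (L : ℕ) (𝔞 : ∀ S : Scales L, ∀ j, Averaging S.P j (SU N))
    (𝔗 : ∀ S : Scales L, ∀ j, RTOpI S.P j (SU N) (𝔞 S j)) :
    ∃ c : Consts L, c.Adm ∧ (∀ S, c.E S = 0) ∧
      ∀ S : Scales L, S.K = 0 → ∀ k, k ≤ S.K → Repr41_47G N (runObjects₀A N 𝔞 𝔗 (Backgrounds.ofAvg N L 𝔞)) c S k := by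
  obtain ⟨h1, h2, h3, -⟩ := Consts.junk_adm L
  refine ⟨{ Consts.junk L with εbg := 3 }, ⟨h1, h2, h3, by show (0 : ℝ) < 3; norm_num⟩, fun _ => rfl, fun S hK k hk => ?_⟩
  exact repr41_47G_of_depthZero hK rfl (by show (0 : ℝ) < 3; norm_num) (Or.inr (by show (2 : ℝ) < 3; norm_num)) k hk

end Consequences

end Summit.QuantumFields.YangMills.BalabanUVNodes.N08Thm2AtRecordDepthZero

end
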